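import Summits.Ventures.DiscreteObjects.Hadamard.ConferenceGraph333PGroupFixed

/-!
# Within-orbit valencies of prime-order automorphisms of srg(333,166,82,83), and: no element of order 41 normalises a
# subgroup of order 83 (no subgroup ℤ/83 ⋊ ℤ/41 of Aut) (kernel)

Framing: lottery ticket; floor = certified bounds/negative ranges.  Cell pub-namedobj (venture DiscreteObjects),
target (H) = `H(668)`, hadamard gen 30.  Orbit-matrix diagonal constraints for the structured families F-Z83 / F-Z41 / F-Z37
(pub-namedobj FAMILY-Z166.md) and a local structure theorem for the Sylow `83`-normaliser.
* **`aut_prime_orbit_valency_bound`** — for `σ` of prime order `p` preserving `A` and a moved vertex `u` with `⟨σ⟩`-orbit `O`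
  (`|O| = p`), the within-orbit valency `D = |N(u) ∩ O|` satisfies **`(p − 1 − 2D)² ≤ 333 − p`**: the class-sum matrix `R` of the
  Seidel matrix over the orbit partition (gen 28, `seidel333_classSum_identities`) has `Σ_j R_{Oj} R_{jO} = 333 − p` with every
  term `≥ 0` (`n_O R_{Oj} = n_j R_{jO}`), and `R_{OO} = p − 1 − 2D`.  Instances: `p = 83 ⇒ 34 ≤ D ≤ 48`; `p = 41 ⇒ 12 ≤ D ≤ 28`;
  `p = 37 ⇒ 10 ≤ D ≤ 26` (`aut_order83/41/37_orbit_valency`).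
* `aut_orbit_valency_even` — `D` has the parity of... more precisely `p·D` is even (the induced graph on `O` is `D`-regular:
  handshake), so `D` is even for odd `p`.
* **`no_order41_normalizing_order83`** — there are no automorphisms `ρ` of order `83` and `τ` of order `41` with
  `τ ρ = ρ^m τ`: `τ` would fix the unique fixed vertex of `ρ` and (having `5` fixed points, `≡ 83 (mod 41)` of them in each
  stable `ρ`-orbit) exactly one vertex `u` in some `ρ`-orbit `O`; then `N(u) ∩ O` is `⟨τ⟩`-invariant without `τ`-fixed points, so
  `41 ∣ D`, i.e. `D ∈ {0, 82}` (`D` even) — contradicting `34 ≤ D ≤ 48`.  Hence NO SUBGROUP OF ORDER `83·41` (such a group is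
  `ℤ/83 ⋊ ℤ/41`), and the normaliser of a Sylow `83`-subgroup of Aut has order coprime to `41`.
WORDS: structure of a HYPOTHETICAL object (no srg(333,166,82,83) / C(334) / H(668) is constructed or excluded); method in print:
orbit matrices (Behbahani–Lam 2011); instance and kernel proofs ours (PROVISIONAL).  No `sorry`, no new definitions.
-/

namespace Summit.Ventures.DiscreteObjects.Hadamard

open Finset

section orbitValency
variable {V : Type*} [Fintype V] [DecidableEq V]

/-- **Within-orbit valency bound** `(p − 1 − 2D)² ≤ 333 − p` for a moved vertex `u` of an automorphism of prime order `p`. -/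
theorem aut_prime_orbit_valency_bound (hV : Fintype.card V = 333) (A : Matrix V V ℤ)
    (h01 : ∀ x y, A x y = 0 ∨ A x y = 1) (hsymm : ∀ x y, A y x = A x y) (hdiag : ∀ x, A x x = 0)
    (hk : ∀ x, ∑ y, A x y = 166) (hsrg : ∀ x y, ∑ z, A x z * A z y = 83 * (1 + (if x = y then 1 else 0)) - A x y)
    {p : ℕ} (hp : p.Prime) (σ : Equiv.Perm V) (hσ : σ ^ p = 1) (hA : ∀ x y, A (σ x) (σ y) = A x y)
    {u : V} (hu : σ u ≠ u) :
    ((p : ℤ) - 1 - 2 * ∑ y ∈ (Finset.range p).image (fun k => (σ ^ k) u), A u y) ^ 2 ≤ 333 - p := by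
  classical
  have hp0 : 0 < p := hp.pos
  obtain ⟨hSd, hSo, hSs, hS1, hSS⟩ := seidel_identities_of_conferenceGraph A h01 hsymm hdiag 83
    (by rw [hV]; norm_num) (fun x => by rw [hk x]; norm_num) hsrg
  set S : V → V → ℤ := fun x y => 1 - (if x = y then 1 else 0) - 2 * A x y with hS_def
  have hSS' : ∀ x y, ∑ z, S x z * S z y = 333 * (if x = y then 1 else 0) - 1 := fun x y => by
    rw [hSS x y, hV]; norm_num
  have hSσ : ∀ x y, S (σ x) (σ y) = S x y := fun x y => by
    simp only [hS_def, hA, σ.injective.eq_iff]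
  -- orbits
  set orb : V → Finset V := fun x => (Finset.range p).image (fun k => (σ ^ k) x) with horb_def
  have horb_mem : ∀ x y, y ∈ orb x ↔ orb y = orb x := fun x y => mem_orbP_iff σ hp0 hσ x y
  have horb_σ : ∀ y, orb (σ y) = orb y := fun y => (horb_mem y (σ y)).mp (by
    simp only [horb_def]
    exact Finset.mem_image.mpr ⟨1, Finset.mem_range.mpr hp.one_lt, by simp⟩)
  set ι := {j : Finset V // j ∈ univ.image orb} with hι_def
  set cls : V → ι := fun x => ⟨orb x, Finset.mem_image_of_mem _ (Finset.mem_univ x)⟩ with hcls_def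
  have hcls_eq : ∀ x y, cls y = cls x ↔ orb y = orb x := fun x y => by
    rw [hcls_def, Subtype.mk.injEq]
  have hcls_σ : ∀ y, cls (σ y) = cls y := fun y => (hcls_eq y (σ y)).mpr (horb_σ y)
  have hcell : ∀ x, (univ.filter fun y => cls y = cls x) = orb x := by
    intro x; ext y
    rw [Finset.mem_filter, hcls_eq, ← horb_mem]
    simp
  have hrep : ∀ i : ι, ∃ x, cls x = i := by
    rintro ⟨j, hj⟩
    obtain ⟨x, -, hx⟩ := Finset.mem_image.mp hj
    exact ⟨x, Subtype.ext hx⟩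
  choose rep hrep using hrep
  have hcellrep : ∀ i : ι, (univ.filter fun y => cls y = i) = orb (rep i) := fun i => by
    rw [← hcell (rep i), hrep]
  set R : Matrix ι ι ℤ := fun i j => ∑ y ∈ univ.filter (fun y => cls y = j), S (rep i) y with hR_def
  have hshift : ∀ r (j : ι), ∑ y ∈ univ.filter (fun y => cls y = j), S (σ r) y =
      ∑ y ∈ univ.filter (fun y => cls y = j), S r y := by
    intro r j
    rw [Finset.sum_filter, Finset.sum_filter]
    exact Fintype.sum_equiv σ.symm _ _ fun y => by
      rw [show cls y = cls (σ (σ.symm y)) by rw [Equiv.apply_symm_apply], hcls_σ,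
        show S (σ r) y = S (σ r) (σ (σ.symm y)) by rw [Equiv.apply_symm_apply], hSσ]
  have hshiftk : ∀ (k : ℕ) r (j : ι), ∑ y ∈ univ.filter (fun y => cls y = j), S ((σ ^ k) r) y =
      ∑ y ∈ univ.filter (fun y => cls y = j), S r y := by
    intro k; induction k with
    | zero => intro r j; simp
    | succ k ih => intro r j; rw [pow_succ', Equiv.Perm.mul_apply, hshift, ih]
  have hR : ∀ x j, ∑ y ∈ univ.filter (fun y => cls y = j), S x y = R (cls x) j := by
    intro x j
    have hx : x ∈ orb (rep (cls x)) := by rw [horb_mem, ← hcls_eq, hrep]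
    obtain ⟨k, -, hkx⟩ := Finset.mem_image.mp hx
    rw [hR_def]; simp only
    conv_lhs => rw [← hkx]
    exact hshiftk k _ j
  have hids := fun i k => seidel333_classSum_identities S hSs hS1 hSS' cls R hR i k (rep i) (hrep i)
  -- class sizes are positive
  have hpos : ∀ j : ι, 0 < ((univ.filter fun y => cls y = j).card : ℤ) := by
    intro j
    have : rep j ∈ univ.filter fun y => cls y = j := Finset.mem_filter.mpr ⟨Finset.mem_univ _, hrep j⟩
    exact_mod_cast Finset.card_pos.mpr ⟨_, this⟩
  -- the class of u has p elements
  set i₀ := cls u with hi₀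
  have hOcard : (orb u).card = p := by
    simp only [horb_def]
    rw [Finset.card_image_of_injOn (orbP_injOn σ hp hσ u hu), Finset.card_range]
  have hcls_u : (univ.filter fun y => cls y = i₀) = orb u := hcell u
  have hni₀ : ((univ.filter fun y => cls y = i₀).card : ℤ) = p := by rw [hcls_u, hOcard]
  -- the row identity at i₀ and nonnegativity of its terms
  have hrow := (hids i₀ i₀).2.1
  rw [if_pos rfl, hni₀] at hrow
  have hnonneg : ∀ j, 0 ≤ R i₀ j * R j i₀ := by
    intro j
    have h3 := (hids i₀ j).2.2
    rw [hni₀] at h3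
    -- p * R i₀ j = n_j * R j i₀ ⇒ n_j * (R i₀ j * R j i₀) = p * R i₀ j ^ 2 ≥ 0
    have hnj := hpos j
    have hkey : ((univ.filter fun y => cls y = j).card : ℤ) * (R i₀ j * R j i₀) = p * (R i₀ j * R i₀ j) := by
      calc ((univ.filter fun y => cls y = j).card : ℤ) * (R i₀ j * R j i₀)
          = R i₀ j * (((univ.filter fun y => cls y = j).card : ℤ) * R j i₀) := by ring
        _ = R i₀ j * ((p : ℤ) * R i₀ j) := by rw [← h3]
        _ = p * (R i₀ j * R i₀ j) := by ring
    have hsq : 0 ≤ (p : ℤ) * (R i₀ j * R i₀ j) := mul_nonneg (by positivity) (mul_self_nonneg _)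
    by_contra hneg
    push Not at hneg
    have := mul_neg_of_pos_of_neg hnj hneg
    linarith
  have hle : R i₀ i₀ * R i₀ i₀ ≤ ∑ j, R i₀ j * R j i₀ :=
    Finset.single_le_sum (f := fun j => R i₀ j * R j i₀) (fun j _ => hnonneg j) (Finset.mem_univ i₀)
  -- R i₀ i₀ = Σ_{y ∈ orb u} S u y = p − 1 − 2 D
  have hRuu : R i₀ i₀ = ∑ y ∈ orb u, S u y := by rw [← hR u i₀, hcls_u]
  have hu_mem : u ∈ orb u := by
    simp only [horb_def]; exact Finset.mem_image.mpr ⟨0, Finset.mem_range.mpr hp0, by simp⟩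
  have hSsum : ∑ y ∈ orb u, S u y = (p : ℤ) - 1 - 2 * ∑ y ∈ orb u, A u y := by
    simp only [hS_def]
    rw [Finset.sum_sub_distrib, Finset.sum_sub_distrib, Finset.sum_const, hOcard, Finset.sum_ite_eq, if_pos hu_mem,
      ← Finset.mul_sum]
    simp
  rw [hRuu, hSsum] at hle
  rw [sq]
  linarith

omit [Fintype V] in
/-- **`p·D` is even**: the graph induced on a `⟨σ⟩`-orbit `O` of a moved vertex is regular of valency `D = |N(u) ∩ O|`, so by the
handshake `|O|·D = p·D` is even (hence `D` is even for odd `p`). -/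
theorem aut_orbit_valency_even (A : Matrix V V ℤ) (hsymm : ∀ x y, A y x = A x y) (hdiag : ∀ x, A x x = 0)
    {p : ℕ} (hp : p.Prime) (σ : Equiv.Perm V) (hσ : σ ^ p = 1) (hA : ∀ x y, A (σ x) (σ y) = A x y)
    {u : V} (hu : σ u ≠ u) :
    2 ∣ (p : ℤ) * ∑ y ∈ (Finset.range p).image (fun k => (σ ^ k) u), A u y := by
  classical
  have hp0 : 0 < p := hp.pos
  set orb : V → Finset V := fun x => (Finset.range p).image (fun k => (σ ^ k) x) with horb_def
  have horb_mem : ∀ x y, y ∈ orb x ↔ orb y = orb x := fun x y => mem_orbP_iff σ hp0 hσ x y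
  have horb_σ : ∀ y, orb (σ y) = orb y := fun y => (horb_mem y (σ y)).mp (by
    simp only [horb_def]
    exact Finset.mem_image.mpr ⟨1, Finset.mem_range.mpr hp.one_lt, by simp⟩)
  have horb_σk : ∀ (k : ℕ) y, orb ((σ ^ k) y) = orb y := by
    intro k; induction k with
    | zero => intro y; simp
    | succ k ih => intro y; rw [pow_succ', Equiv.Perm.mul_apply, horb_σ, ih]
  have hmemk : ∀ (k : ℕ) y, (σ ^ k) y ∈ orb u ↔ y ∈ orb u := by
    intro k y; rw [horb_mem, horb_mem, horb_σk]
  have hOcard : (orb u).card = p := by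
    simp only [horb_def]
    rw [Finset.card_image_of_injOn (orbP_injOn σ hp hσ u hu), Finset.card_range]
  have hdeg : ∀ x ∈ orb u, ∑ y ∈ orb u, A x y = ∑ y ∈ orb u, A u y := by
    intro x hx
    obtain ⟨k, -, rfl⟩ := Finset.mem_image.mp hx
    symm
    refine Finset.sum_nbij (fun y => (σ ^ k) y) (fun y hy => (hmemk k y).mpr hy) ((σ ^ k).injective.injOn)
      (fun y hy => ⟨(σ ^ k).symm y, ?_, by simp⟩) (fun y _ => (adj_pow_invariant A σ hA k u y).symm)
    have : (σ ^ k) ((σ ^ k).symm y) ∈ orb u := by simpa using hy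
    exact (hmemk k _).mp this
  have heven := sum_sum_adj_even A hsymm hdiag (orb u)
  rw [Finset.sum_congr rfl hdeg, Finset.sum_const, hOcard, nsmul_eq_mul] at heven
  exact heven

/-- the valency window for `p = 83`: `34 ≤ D ≤ 48`. -/
theorem aut_order83_orbit_valency (hV : Fintype.card V = 333) (A : Matrix V V ℤ)
    (h01 : ∀ x y, A x y = 0 ∨ A x y = 1) (hsymm : ∀ x y, A y x = A x y) (hdiag : ∀ x, A x x = 0)
    (hk : ∀ x, ∑ y, A x y = 166) (hsrg : ∀ x y, ∑ z, A x z * A z y = 83 * (1 + (if x = y then 1 else 0)) - A x y)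
    (σ : Equiv.Perm V) (hσ : σ ^ 83 = 1) (hA : ∀ x y, A (σ x) (σ y) = A x y) {u : V} (hu : σ u ≠ u) :
    34 ≤ ∑ y ∈ (Finset.range 83).image (fun k => (σ ^ k) u), A u y ∧
      ∑ y ∈ (Finset.range 83).image (fun k => (σ ^ k) u), A u y ≤ 48 := by
  have h := aut_prime_orbit_valency_bound hV A h01 hsymm hdiag hk hsrg (by norm_num : Nat.Prime 83) σ hσ hA hu
  set D := ∑ y ∈ (Finset.range 83).image (fun k => (σ ^ k) u), A u y with hD
  simp only [Nat.cast_ofNat] at h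
  have h1 : (83 : ℤ) - 1 - 2 * D ≤ 15 := by nlinarith
  have h2 : -15 ≤ (83 : ℤ) - 1 - 2 * D := by nlinarith
  constructor <;> omega

/-- the valency window for `p = 41`: `12 ≤ D ≤ 28`. -/
theorem aut_order41_orbit_valency (hV : Fintype.card V = 333) (A : Matrix V V ℤ)
    (h01 : ∀ x y, A x y = 0 ∨ A x y = 1) (hsymm : ∀ x y, A y x = A x y) (hdiag : ∀ x, A x x = 0)
    (hk : ∀ x, ∑ y, A x y = 166) (hsrg : ∀ x y, ∑ z, A x z * A z y = 83 * (1 + (if x = y then 1 else 0)) - A x y)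
    (σ : Equiv.Perm V) (hσ : σ ^ 41 = 1) (hA : ∀ x y, A (σ x) (σ y) = A x y) {u : V} (hu : σ u ≠ u) :
    12 ≤ ∑ y ∈ (Finset.range 41).image (fun k => (σ ^ k) u), A u y ∧
      ∑ y ∈ (Finset.range 41).image (fun k => (σ ^ k) u), A u y ≤ 28 := by
  have h := aut_prime_orbit_valency_bound hV A h01 hsymm hdiag hk hsrg (by norm_num : Nat.Prime 41) σ hσ hA hu
  set D := ∑ y ∈ (Finset.range 41).image (fun k => (σ ^ k) u), A u y with hD
  simp only [Nat.cast_ofNat] at h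
  have h1 : (41 : ℤ) - 1 - 2 * D ≤ 17 := by nlinarith
  have h2 : -17 ≤ (41 : ℤ) - 1 - 2 * D := by nlinarith
  constructor <;> omega

/-- the valency window for `p = 37`: `10 ≤ D ≤ 26`. -/
theorem aut_order37_orbit_valency (hV : Fintype.card V = 333) (A : Matrix V V ℤ)
    (h01 : ∀ x y, A x y = 0 ∨ A x y = 1) (hsymm : ∀ x y, A y x = A x y) (hdiag : ∀ x, A x x = 0)
    (hk : ∀ x, ∑ y, A x y = 166) (hsrg : ∀ x y, ∑ z, A x z * A z y = 83 * (1 + (if x = y then 1 else 0)) - A x y)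
    (σ : Equiv.Perm V) (hσ : σ ^ 37 = 1) (hA : ∀ x y, A (σ x) (σ y) = A x y) {u : V} (hu : σ u ≠ u) :
    10 ≤ ∑ y ∈ (Finset.range 37).image (fun k => (σ ^ k) u), A u y ∧
      ∑ y ∈ (Finset.range 37).image (fun k => (σ ^ k) u), A u y ≤ 26 := by
  have h := aut_prime_orbit_valency_bound hV A h01 hsymm hdiag hk hsrg (by norm_num : Nat.Prime 37) σ hσ hA hu
  set D := ∑ y ∈ (Finset.range 37).image (fun k => (σ ^ k) u), A u y with hD
  simp only [Nat.cast_ofNat] at h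
  have h1 : (37 : ℤ) - 1 - 2 * D ≤ 17 := by nlinarith
  have h2 : -17 ≤ (37 : ℤ) - 1 - 2 * D := by nlinarith
  constructor <;> omega

/-! ## No element of order 41 normalises a subgroup of order 83 -/

/-- **No `ℤ/83 ⋊ ℤ/41` in Aut(srg(333,166,82,83)).**  If `ρ` has order `83`, `τ` has order `41` and `τρ = ρ^m τ`, contradiction. -/
theorem no_order41_normalizing_order83 (hV : Fintype.card V = 333) (A : Matrix V V ℤ)
    (h01 : ∀ x y, A x y = 0 ∨ A x y = 1) (hsymm : ∀ x y, A y x = A x y) (hdiag : ∀ x, A x x = 0)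
    (hk : ∀ x, ∑ y, A x y = 166) (hsrg : ∀ x y, ∑ z, A x z * A z y = 83 * (1 + (if x = y then 1 else 0)) - A x y)
    (ρ τ : Equiv.Perm V) (hρ : ρ ^ 83 = 1) (hρ1 : ρ ≠ 1) (hτ : τ ^ 41 = 1) (hτ1 : τ ≠ 1)
    (hAρ : ∀ x y, A (ρ x) (ρ y) = A x y) (hAτ : ∀ x y, A (τ x) (τ y) = A x y)
    {m : ℕ} (hnorm : τ * ρ = ρ ^ m * τ) : False := by
  classical
  have hp83 : Nat.Prime 83 := by norm_num
  have hp41 : Nat.Prime 41 := by norm_num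
  haveI : Fact (Nat.Prime 41) := ⟨hp41⟩
  -- fixed points: ρ has exactly one, τ exactly five
  obtain ⟨-, -, -, -, -, -, -, -, -, w83⟩ := aut_prime_windows_fs hV A h01 hsymm hdiag hk hsrg hp83 (by norm_num) ρ hρ hρ1 hAρ
  have hfρ : (univ.filter fun x => ρ x = x).card = 1 := w83 rfl
  obtain ⟨-, -, -, -, -, -, -, -, w41, -⟩ := aut_prime_windows_fs hV A h01 hsymm hdiag hk hsrg hp41 (by norm_num) τ hτ hτ1 hAτ
  have hfτ : (univ.filter fun x => τ x = x).card = 5 := w41 rfl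
  -- τ ρ^k = ρ^(m k) τ
  have hnormk : ∀ k : ℕ, τ * ρ ^ k = ρ ^ (m * k) * τ := by
    intro k; induction k with
    | zero => simp
    | succ k ih => rw [pow_succ, ← mul_assoc, ih, mul_assoc, hnorm, ← mul_assoc, ← pow_add, Nat.mul_succ]
  -- the unique fixed vertex ∞ of ρ is fixed by τ; hence τ fixes some u ≠ ∞, which ρ moves
  obtain ⟨u, hτu, hρu⟩ : ∃ u, τ u = u ∧ ρ u ≠ u := by
    by_contra hc
    push Not at hc
    -- then Fix τ ⊆ Fix ρ, so 5 ≤ 1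
    have hsub : (univ.filter fun x => τ x = x) ⊆ (univ.filter fun x => ρ x = x) := by
      intro x hx
      rw [Finset.mem_filter] at hx ⊢
      exact ⟨hx.1, hc x hx.2⟩
    have := Finset.card_le_card hsub
    omega
  -- the ρ-orbit O of u is τ-invariant
  set O := (Finset.range 83).image (fun k => (ρ ^ k) u) with hO_def
  have hOτ : ∀ y ∈ O, τ y ∈ O := by
    intro y hy
    obtain ⟨k, -, rfl⟩ := Finset.mem_image.mp hy
    have : τ ((ρ ^ k) u) = (ρ ^ (m * k)) (τ u) := by
      rw [← Equiv.Perm.mul_apply, hnormk, Equiv.Perm.mul_apply]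
    rw [this, hτu, perm_pow_apply_mod ρ hρ]
    exact Finset.mem_image.mpr ⟨(m * k) % 83, Finset.mem_range.mpr (Nat.mod_lt _ (by norm_num)), rfl⟩
  have hOcard : O.card = 83 := by
    rw [hO_def, Finset.card_image_of_injOn (orbP_injOn ρ hp83 hρ u hρu), Finset.card_range]
  have hu_mem : u ∈ O := Finset.mem_image.mpr ⟨0, by simp, by simp⟩
  -- invariance under the whole group ⟨τ⟩
  have hzp : ∀ (T : Finset V), (∀ y ∈ T, τ y ∈ T) → ∀ g ∈ Subgroup.zpowers τ, ∀ y ∈ T, g y ∈ T := by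
    intro T hT g hg y hy
    obtain ⟨n, rfl⟩ := (Submonoid.mem_powers_iff _ _).mp (mem_powers_iff_mem_zpowers.mpr hg)
    clear hg
    induction n generalizing y with
    | zero => simpa using hy
    | succ n ih => rw [pow_succ', Equiv.Perm.mul_apply]; exact hT _ (ih y hy)
  have hPG := isPGroup_zpowers_of_pow_eq_one τ (p := 41) (e := 1) (by simpa using hτ)
  set F := univ.filter fun x => τ x = x with hF_def
  have hFmem := mem_filter_fixed_iff_zpowers τ
  -- |O ∩ Fix τ| ≡ 83 (mod 41), and it contains u but not ∞... so it is 1: O ∩ F = {u}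
  have hOF := pgroup_card_modEq_card_fixed (Subgroup.zpowers τ) hPG F hFmem O (hzp O hOτ)
  rw [hOcard] at hOF
  -- ∞ : the fixed vertex of ρ is not in O (all of O is moved by ρ), and F has 5 elements one of which is ∞
  obtain ⟨xinf, hxinf⟩ : ∃ x, ρ x = x := by
    have : (univ.filter fun x => ρ x = x).Nonempty := by rw [← Finset.card_pos, hfρ]; norm_num
    obtain ⟨x, hx⟩ := this
    exact ⟨x, (Finset.mem_filter.mp hx).2⟩
  have hτinf : τ xinf = xinf := by
    -- τ xinf is fixed by ρ^m... and ρ = (ρ^m)^? ; simpler: ρ^m (τ xinf) = τ (ρ xinf) = τ xinf, and Fix ρ^m ⊇ ... use uniqueness of the ρ-fixed point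
    have h1 : (ρ ^ m) (τ xinf) = τ xinf := by
      have := congrArg (fun g : Equiv.Perm V => g xinf) hnorm
      simp only [Equiv.Perm.coe_mul, Function.comp_apply, hxinf] at this
      exact this.symm
    -- m is coprime to 83 unless ρ^m = 1; if ρ^m = 1 then τ ρ = τ, ρ = 1: contradiction
    by_cases hm : ρ ^ m = 1
    · exfalso; apply hρ1
      have : τ * ρ = τ := by rw [hnorm, hm, one_mul]
      exact mul_left_cancel (a := τ) (by rw [this, mul_one])
    · -- ρ^m ≠ 1 has the same fixed points as ρ (prime order): Fix(ρ^m) has card 1 too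
      have hρm83 : (ρ ^ m) ^ 83 = 1 := by rw [← pow_mul, mul_comm, pow_mul, hρ, one_pow]
      obtain ⟨-, -, -, -, -, -, -, -, -, w83m⟩ := aut_prime_windows_fs hV A h01 hsymm hdiag hk hsrg hp83 (by norm_num) (ρ ^ m)
        hρm83 hm (adj_pow_invariant A ρ hAρ m)
      have hf1 : (univ.filter fun x => (ρ ^ m) x = x).card = 1 := w83m rfl
      obtain ⟨z, hz⟩ := Finset.card_eq_one.mp hf1
      have hmem1 : τ xinf ∈ univ.filter fun x => (ρ ^ m) x = x := Finset.mem_filter.mpr ⟨Finset.mem_univ _, h1⟩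
      have hmem2 : xinf ∈ univ.filter fun x => (ρ ^ m) x = x :=
        Finset.mem_filter.mpr ⟨Finset.mem_univ _, Equiv.Perm.pow_apply_eq_self_of_apply_eq_self hxinf m⟩
      rw [hz, Finset.mem_singleton] at hmem1 hmem2
      rw [hmem1, hmem2]
  have hinfO : xinf ∉ O := by
    intro h
    obtain ⟨k, -, hkx⟩ := Finset.mem_image.mp h
    -- ρ^k u = xinf is ρ-fixed ⇒ u is ρ-fixed
    apply hρu
    have : ρ ((ρ ^ k) u) = (ρ ^ k) u := by rw [hkx, hxinf]
    rw [← perm_pow_apply_comm] at this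
    exact (ρ ^ k).injective this
  -- card (O ∩ F): contains u, misses xinf ∈ F, F has 5 elements ⇒ ≤ 4; ≡ 83 ≡ 1 (mod 41) ⇒ = 1
  have hOF_le : (O ∩ F).card ≤ 4 := by
    have hsub : O ∩ F ⊆ F.erase xinf := by
      intro y hy
      rw [Finset.mem_inter] at hy
      exact Finset.mem_erase.mpr ⟨fun h => hinfO (h ▸ hy.1), hy.2⟩
    have hxF : xinf ∈ F := Finset.mem_filter.mpr ⟨Finset.mem_univ _, hτinf⟩
    have := Finset.card_le_card hsub
    rw [Finset.card_erase_of_mem hxF, hfτ] at this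
    exact this
  have hOF1 : (O ∩ F).card = 1 := by
    have h := hOF  -- 83 ≡ card [MOD 41]
    unfold Nat.ModEq at h
    omega
  have hOF_eq : O ∩ F = {u} := by
    obtain ⟨z, hz⟩ := Finset.card_eq_one.mp hOF1
    have : u ∈ O ∩ F := Finset.mem_inter.mpr ⟨hu_mem, Finset.mem_filter.mpr ⟨Finset.mem_univ _, hτu⟩⟩
    rw [hz, Finset.mem_singleton] at this
    rw [hz, this]
  -- S = N(u) ∩ O is ⟨τ⟩-invariant and misses Fix τ ⇒ 41 ∣ D
  set Su := O.filter (fun y => A u y = 1) with hSu_def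
  have hSuτ : ∀ y ∈ Su, τ y ∈ Su := by
    intro y hy
    rw [hSu_def, Finset.mem_filter] at hy ⊢
    refine ⟨hOτ y hy.1, ?_⟩
    rw [← hy.2]
    conv_lhs => rw [← hτu]
    exact hAτ u y
  have hSuF := pgroup_card_modEq_card_fixed (Subgroup.zpowers τ) hPG F hFmem Su (hzp Su hSuτ)
  have hSuF0 : (Su ∩ F).card = 0 := by
    rw [Finset.card_eq_zero, Finset.eq_empty_iff_forall_notMem]
    intro y hy
    rw [Finset.mem_inter] at hy
    have hyO : y ∈ O ∩ F := Finset.mem_inter.mpr ⟨(Finset.mem_filter.mp hy.1).1, hy.2⟩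
    rw [hOF_eq, Finset.mem_singleton] at hyO
    have := (Finset.mem_filter.mp hy.1).2
    rw [hyO, hdiag] at this
    norm_num at this
  rw [hSuF0] at hSuF
  -- D = |Su| as the 0/1 sum
  have hD : ∑ y ∈ O, A u y = (Su.card : ℤ) := by
    rw [hSu_def]; exact sum01_eq_card_filter (fun y => A u y) (h01 u) O
  -- bounds and parity
  obtain ⟨hlo, hhi⟩ := aut_order83_orbit_valency hV A h01 hsymm hdiag hk hsrg ρ hρ hAρ hρu
  have hev := aut_orbit_valency_even A hsymm hdiag hp83 ρ hρ hAρ hρu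
  rw [hD] at hlo hhi hev
  unfold Nat.ModEq at hSuF
  push_cast at hev
  omega

end orbitValency

end Summit.Ventures.DiscreteObjects.Hadamard
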